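import Summits.NavierStokesRegularity.NavierStokesRegularity.Theorems.ApexLocalisation.Negative.LogicAndLoadBearing

/-!
# `ApexLocalisation` (crux stmt-NavierStokesRegularity-11719): the lines' first lemmas, I —
# (L)-vacuity of every universal stub over the singular rate class
# — negative-side support (cdisprove seat, gen 3)

Fifth file of importable lemmas of the standing disprover of `RellichScar.ApexLocalisation`
(companions: `Negative/LogicAndLoadBearing.lean` — imported —, `Negative/FinalSlice.lean`,
`Negative/AEForm.lean`, `Negative/KinematicLoadBearing.lean`). It concerns the typed first lemmas
of the crux lines published in `Cruxes/ApexLocalisation/SketchIdeator1.lean`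
(`RateClassSingular`, `AnnularDissipationQuantum(Exists)`, `LowDissipationIsolation` — line
`dissipation-quantum-tolerance`) and `Cruxes/ApexLocalisation/Ideator3Sketch.lean`
(`Sketch.InRateClass`, `Sketch.ConfinementImpliesApex`, `Sketch.FinalSliceRadialNull` — lines
`activity-genealogy-fission` / `baire-onion-normal-form`). `Theorems/` files may not import crux
workfiles, so §0 re-declares those statements VERBATIM in the sub-namespace `Lines` (the
disprover's work file `Cruxes/ApexLocalisation/Disproof.lean` imports both and certifies the
copies are definitionally the originals, by `Iff.rfl`). All sorry-free. This file holds §0–§A; the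
companion `Negative/LinesLoadBearing.lean` holds §B–§D.

* §A DICTIONARY AND (L)-VACUITY. `RateClassSingular C M` (the ideators' hypothesis class with the
  constants exposed) is exactly the disprover's `IsRateProfile C` with `𝐈 ≤ M`
  (`rateProfileExists_iff_exists_rateClassSingular`). Consequently EVERY stub of the shape
  `∀ (u,p,G) ∈ RateClassSingular C M, …` follows from `¬ RateProfileExists` (= stmt-1588, the
  situation under the KNSS Liouville conjecture) — `forall_rateClassSingular_of_not_rateProfileExists` —
  and every stub of the shape `∃ (u,p,G) ∈ RateClassSingular C M, …` EXHIBITS a Type-I singularity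
  (`localTypeISingularityExists_of_exists_rateClassSingular`, Albritton–Barker's open first
  bullet). In particular `AnnularDissipationQuantum(Exists)` and `LowDissipationIsolation` are
  (L)-theorems for free (`…_of_not_rateProfileExists`): like the crux itself
  (`Negative/LogicAndLoadBearing`), no universal stub of these lines is refutable short of a
  Type-I blow-up, and an unguarded existential stub ("the band infimum is ATTAINED by a profile")
  is at least as hard as constructing one. The disprover can therefore only kill MIS-STATEMENTS;
  §B–§D record which omissions are fatal.
* §B THE DISSIPATION QUANTUM NEEDS `𝐈 ≤ M` AND THE SINGULAR POINT. With `𝐈 ≤ M` dropped the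
  quantum fails for every `C > 0`, `e > 0` (`annularDissipationQuantum_false_without_I`): the
  parasitic flow `u = C e₀/√(−t)` (KNSS 2009 §1; library `ParasiticSlabFlow`) is a suitable weak
  solution with the rate, singular at the origin, and has ZERO dissipation (`∇u = 0`). With the
  singular origin dropped it fails by the zero flow (`annularDissipationQuantum_false_without_Sing`).
  For `e ≤ 0` the quantum is trivially true (`annularDissipationQuantum_of_nonpos`); it is antitone
  in `e`, `M` and monotone in `C` (bookkeeping for the prover).
* §C THE CONFINEMENT CRITERION NEEDS `𝐈 ≤ M`. `Sketch.ConfinementImpliesApex` with the Morrey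
  bound dropped is false (`confinementImpliesApex_false_without_I`): the SMALL parasitic flow
  `u = a e₀/√(−t)`, `a = min η 1`, is `η`-confined (indeed `√(−t)‖u‖ = a` everywhere), has the
  rate with constant `1`, and violates every a.e. apex bound on the positive-measure set
  `(−1,−¼) × B₁(x₀)`, `‖x₀‖ = |C'|/a + 3`. So the threshold `η` cannot absorb the Morrey input:
  localized smoothing genuinely needs `A ≤ 𝐈 ≤ M`, as the card says.
* §D FINAL-SLICE SPARSITY NEEDS `𝐈 ≤ M`. `Sketch.FinalSliceRadialNull` with the Morrey bound
  dropped is false (`finalSliceRadialNull_false_without_I`): the parasitic flow is singular at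
  every final-slice point (`Negative/FinalSlice`: `Σ = ℝ³`), so the radial image of `Σ` is
  `[0, ∞)`, of infinite length.

## References

* G. Koch, N. Nadirashvili, G. Seregin, V. Šverák, Acta Math. 203 (2009), §1 (parasitic solutions; (1.4), (1.6)). [KNSS2009]
* D. Albritton, T. Barker, J. Math. Fluid Mech. 21 (2019) = arXiv:1811.00502, §1, Thm 1.1. [AlbrittonBarker2019]
* L. Caffarelli, R. Kohn, L. Nirenberg, CPAM 35 (1982), §2, §6. [CaffarelliKohnNirenberg1982]
-/

noncomputable section

open MeasureTheory TopologicalSpace Set Function Filter Topology Metric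
open scoped InnerProductSpace RealInnerProductSpace ENNReal NNReal
open Literature.Analysis.FluidPDE
open Summit.NavierStokesRegularity.NavierStokesRegularity.Theses

set_option linter.dupNamespace false

namespace Summit.NavierStokesRegularity.NavierStokesRegularity.Theorems.ApexLocalisation.Negative

/-- Physical space. -/
local notation "ℝ³" => EuclideanSpace ℝ (Fin 3)

/-- The open backward slab `(-∞,0) × ℝ³` (time first), as in the route file. -/
local notation "𝕊" => Literature.Analysis.FluidPDE.slab (EuclideanSpace ℝ (Fin 3)) (Set.Iio (0 : ℝ)) isOpen_Iio

/-! ## §0 The ideators' first lemmas, verbatim (source: `Cruxes/ApexLocalisation/SketchIdeator1.lean`,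
`Cruxes/ApexLocalisation/Ideator3Sketch.lean`; only the notation `E³ ↦ ℝ³`, `negSlab ↦ 𝕊` differs) -/

namespace Lines

/-- [verbatim `Cruxes.ApexLocalisation.RateClassSingular`] The hypothesis class of the crux with
explicit constants: rate `C`, Albritton–Barker quantity `𝐈 ≤ M`, singular at the origin. -/
def RateClassSingular (C M : ℝ) (u : ℝ → ℝ³ → ℝ³) (p : ℝ → ℝ³ → ℝ)
    (G : ℝ → ℝ³ → ℝ³ →L[ℝ] ℝ³) : Prop :=
  IsSuitableWeakSolutionOn 𝕊 1 0 u p ∧ HasWeakSpatialGradientOn 𝕊 u G ∧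
    typeIBound (Iio (0 : ℝ) ×ˢ univ) u p G ≤ ENNReal.ofReal M ∧ HasTypeITimeDecay C u ∧
    IsBackwardSingularPoint u 0

/-- [verbatim `Cruxes.ApexLocalisation.AnnularDissipationQuantum`] Every profile of the class
dissipates at least `e` in the unit backward annular band `(-1,-1/4) × B₁(0)`. -/
def AnnularDissipationQuantum (C M e : ℝ) : Prop :=
  ∀ (u : ℝ → ℝ³ → ℝ³) (p : ℝ → ℝ³ → ℝ) (G : ℝ → ℝ³ → ℝ³ →L[ℝ] ℝ³),
    RateClassSingular C M u p G →
      ENNReal.ofReal e ≤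
        ∫⁻ q in (Ioo (-1 : ℝ) (-1 / 4)) ×ˢ ball (0 : ℝ³) 1, ENNReal.ofReal (frobeniusNormSq (G q.1 q.2))

/-- [verbatim `Cruxes.ApexLocalisation.AnnularDissipationQuantumExists`] -/
def AnnularDissipationQuantumExists : Prop :=
  ∀ C M : ℝ, ∃ e : ℝ, 0 < e ∧ AnnularDissipationQuantum C M e

/-- [verbatim `Cruxes.ApexLocalisation.LowDissipationIsolation`] The tolerance criterion:
quantum `e` + `sup_r E(Q((0,0),r)) < (9/4) e` ⇒ the origin is the only final-time singular point. -/
def LowDissipationIsolation : Prop :=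
  ∀ (C M e : ℝ), 0 < e → AnnularDissipationQuantum C M e →
    ∀ (u : ℝ → ℝ³ → ℝ³) (p : ℝ → ℝ³ → ℝ) (G : ℝ → ℝ³ → ℝ³ →L[ℝ] ℝ³),
      RateClassSingular C M u p G →
      (⨆ (r : ℝ) (_ : 0 < r), cknE r ((0 : ℝ), (0 : ℝ³)) G) < ENNReal.ofReal (9 / 4 * e) →
      ∀ x : ℝ³, x ≠ 0 → ¬ IsBackwardSingularPoint u ((0 : ℝ), x)

/-- [verbatim `Cruxes.ApexLocalisation.Sketch.InRateClass`] The rate class WITHOUT a singular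
point (lines `activity-genealogy-fission` / `baire-onion-normal-form`). -/
def InRateClass (M : ℝ≥0) (C : ℝ) (u : ℝ → ℝ³ → ℝ³) (p : ℝ → ℝ³ → ℝ)
    (G : ℝ → ℝ³ → ℝ³ →L[ℝ] ℝ³) : Prop :=
  IsSuitableWeakSolutionOn 𝕊 1 0 u p ∧ HasWeakSpatialGradientOn 𝕊 u G ∧
    typeIBound (Iio (0 : ℝ) ×ˢ univ) u p G ≤ (M : ℝ≥0∞) ∧ HasTypeITimeDecay C u

/-- [verbatim `Cruxes.ApexLocalisation.Sketch.ConfinementImpliesApex`] "Apex = Type-I-small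
outside a paraboloid". -/
def ConfinementImpliesApex : Prop :=
  ∀ (M : ℝ≥0) (C : ℝ), ∃ η : ℝ, 0 < η ∧ ∀ R : ℝ, 0 < R → ∃ C' : ℝ,
    ∀ (u : ℝ → ℝ³ → ℝ³) (p : ℝ → ℝ³ → ℝ) (G : ℝ → ℝ³ → ℝ³ →L[ℝ] ℝ³),
      InRateClass M C u p G →
      (∀ t : ℝ, t < 0 → ∀ x : ℝ³, R * Real.sqrt (-t) ≤ ‖x‖ → Real.sqrt (-t) * ‖u t x‖ ≤ η) →
      ∀ᵐ z : ℝ × ℝ³ ∂(volume.restrict (Iio (0 : ℝ) ×ˢ univ)),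
        ‖u z.1 z.2‖ ≤ C' / (‖z.2‖ + Real.sqrt (-z.1))

/-- [verbatim `Cruxes.ApexLocalisation.Sketch.finalSingularSet`; equal to `Negative/FinalSlice`'s
`finalSliceSingularSet`] The final-time singular set. -/
def finalSingularSet (u : ℝ → ℝ³ → ℝ³) : Set ℝ³ :=
  {x | IsBackwardSingularPoint u ((0 : ℝ), x)}

/-- [verbatim `Cruxes.ApexLocalisation.Sketch.FinalSliceRadialNull`] Final-slice sparsity:
`Σ` closed, `ℋ¹(Σ) = 0`, radial images closed and Lebesgue-null. -/
def FinalSliceRadialNull : Prop :=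
  ∀ (M : ℝ≥0) (C : ℝ) (u : ℝ → ℝ³ → ℝ³) (p : ℝ → ℝ³ → ℝ) (G : ℝ → ℝ³ → ℝ³ →L[ℝ] ℝ³),
    InRateClass M C u p G →
      IsClosed (finalSingularSet u) ∧ μH[1] (finalSingularSet u) = 0 ∧
        ∀ x₀ : ℝ³, IsClosed ((fun x : ℝ³ => ‖x - x₀‖) '' finalSingularSet u) ∧
          volume ((fun x : ℝ³ => ‖x - x₀‖) '' finalSingularSet u) = 0

end Lines

open Lines

variable {C M e : ℝ} {u : ℝ → ℝ³ → ℝ³} {p : ℝ → ℝ³ → ℝ} {G : ℝ → ℝ³ → ℝ³ →L[ℝ] ℝ³}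

/-! ## §A Dictionary `RateClassSingular` ↔ `IsRateProfile`, and (L)-vacuity of universal stubs -/

/-- A member of the ideators' class `RateClassSingular C M` (`𝐈 ≤ M`) is a rate profile. -/
theorem IsRateProfile.of_rateClassSingular (h : RateClassSingular C M u p G) :
    IsRateProfile C u p G :=
  ⟨h.1, h.2.1, lt_of_le_of_lt h.2.2.1 ENNReal.ofReal_lt_top, h.2.2.2.1, h.2.2.2.2⟩

/-- Conversely every rate profile is in `RateClassSingular C M` with `M = 𝐈.toReal`. -/
theorem IsRateProfile.rateClassSingular (h : IsRateProfile C u p G) :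
    RateClassSingular C (typeIBound (Set.Iio (0 : ℝ) ×ˢ Set.univ) u p G).toReal u p G :=
  ⟨h.1, h.2.1, (ENNReal.ofReal_toReal h.2.2.1.ne).ge, h.2.2.2.1, h.2.2.2.2⟩

/-- A member of `RateClassSingular C M` witnesses `RateProfileExists`. -/
theorem rateProfileExists_of_rateClassSingular (h : RateClassSingular C M u p G) :
    RateProfileExists :=
  ⟨C, u, p, G, IsRateProfile.of_rateClassSingular h⟩

/-- **Dictionary.** The antecedent of the crux is inhabited iff some `RateClassSingular C M` is. -/
theorem rateProfileExists_iff_exists_rateClassSingular :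
    RateProfileExists ↔
      ∃ (C M : ℝ) (u : ℝ → ℝ³ → ℝ³) (p : ℝ → ℝ³ → ℝ) (G : ℝ → ℝ³ → ℝ³ →L[ℝ] ℝ³),
        RateClassSingular C M u p G := by
  constructor
  · rintro ⟨C, u, p, G, h⟩
    exact ⟨C, _, u, p, G, h.rateClassSingular⟩
  · rintro ⟨C, M, u, p, G, h⟩
    exact rateProfileExists_of_rateClassSingular h

/-- **Every universal stub over the singular rate class is (L)-vacuous**: granted
`¬ RateProfileExists` (= stmt-1588; true under the KNSS Liouville conjecture), ANY property holds
for all members of every `RateClassSingular C M`. So no such stub is refutable short of a Type-I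
blow-up — exactly like the crux (`Negative/LogicAndLoadBearing.not_apexLocalisation_iff`). -/
theorem forall_rateClassSingular_of_not_rateProfileExists (hno : ¬ RateProfileExists)
    (P : ℝ → ℝ → (ℝ → ℝ³ → ℝ³) → (ℝ → ℝ³ → ℝ) → (ℝ → ℝ³ → ℝ³ →L[ℝ] ℝ³) → Prop)
    (C M : ℝ) (u : ℝ → ℝ³ → ℝ³) (p : ℝ → ℝ³ → ℝ) (G : ℝ → ℝ³ → ℝ³ →L[ℝ] ℝ³)
    (h : RateClassSingular C M u p G) : P C M u p G :=
  absurd (rateProfileExists_of_rateClassSingular h) hno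

/-- **Every existential stub over the singular rate class exhibits a Type-I singularity**
(Albritton–Barker 2019, Thm 1.1, first bullet — the registered OPEN statement
`LocalTypeISingularityExists`, false under (L)): an unguarded "the infimum is ATTAINED by a
profile of the class" is at least as hard as constructing Type-I blow-up. -/
theorem localTypeISingularityExists_of_exists_rateClassSingular
    (P : ℝ → ℝ → (ℝ → ℝ³ → ℝ³) → (ℝ → ℝ³ → ℝ) → (ℝ → ℝ³ → ℝ³ →L[ℝ] ℝ³) → Prop)
    (h : ∃ (C M : ℝ) (u : ℝ → ℝ³ → ℝ³) (p : ℝ → ℝ³ → ℝ) (G : ℝ → ℝ³ → ℝ³ →L[ℝ] ℝ³),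
      RateClassSingular C M u p G ∧ P C M u p G) :
    LocalTypeISingularityExists := by
  obtain ⟨C, M, u, p, G, h, -⟩ := h
  exact (IsRateProfile.of_rateClassSingular h).localTypeISingularityExists

/-- The dissipation quantum (line `dissipation-quantum-tolerance`, first lemma) holds for every
`(C, M, e)` once the antecedent class of the crux is empty. -/
theorem annularDissipationQuantum_of_not_rateProfileExists (hno : ¬ RateProfileExists)
    (C M e : ℝ) : AnnularDissipationQuantum C M e :=
  fun _ _ _ h => absurd (rateProfileExists_of_rateClassSingular h) hno

/-- ... hence `AnnularDissipationQuantumExists` is an (L)-theorem for free. -/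
theorem annularDissipationQuantumExists_of_not_rateProfileExists (hno : ¬ RateProfileExists) :
    AnnularDissipationQuantumExists :=
  fun C M => ⟨1, one_pos, annularDissipationQuantum_of_not_rateProfileExists hno C M 1⟩

/-- ... and so is the tolerance criterion `LowDissipationIsolation`. -/
theorem lowDissipationIsolation_of_not_rateProfileExists (hno : ¬ RateProfileExists) :
    LowDissipationIsolation :=
  fun _ _ _ _ _ _ _ _ h _ _ _ => absurd (rateProfileExists_of_rateClassSingular h) hno

/-- The same three, from "no Type-I singular point" (¬ A–B first bullet). -/
theorem quantumLine_of_not_localTypeISingularityExists (hno : ¬ LocalTypeISingularityExists) :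
    AnnularDissipationQuantumExists ∧ LowDissipationIsolation ∧ RellichScar.ApexLocalisation :=
  have h1588 : ¬ RateProfileExists :=
    fun hr => hno (localTypeISingularityExists_of_rateProfileExists hr)
  ⟨annularDissipationQuantumExists_of_not_rateProfileExists h1588,
    lowDissipationIsolation_of_not_rateProfileExists h1588,
    apexLocalisation_of_not_rateProfileExists h1588⟩

end Summit.NavierStokesRegularity.NavierStokesRegularity.Theorems.ApexLocalisation.Negative
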